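import Summits.AtomisticToContinuum.FouriersLaw.Theses.MatthiessenLadder
import Summits.AtomisticToContinuum.FouriersLaw.Theorems.MatthiessenLadderPrefixSteadyStatesStubSteadyStateOfSemigroupBound
import Literature.MathematicalPhysics.KineticTheory.CellChainLangevin
import Literature.MathematicalPhysics.KineticTheory.SiteChainResponseStar
import Literature.MathematicalPhysics.KineticTheory.SiteChainResponseUniformDecay
import HarnessLib

/-!
# `PrefixSteadyStates`, line `registered` — stub `stub_prefixResponseOfUniformMixing`

Crux item `stmt-AtomisticToContinuum-12778` (route `MatthiessenLadder`, decl `…MatthiessenLadder.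
PrefixSteadyStates`): the soft half (G4+G5+G6) of the finite-volume linear response of the prefix rung
`cellChain ω₂ lam β γ (· < k)` (`0 < k < N`, all parameters `> 0`). HYPOTHESES: weak-NESS existence and
uniqueness at size `N` for all bath temperatures, and, near `(T, T)`, a `V`-uniform mixing estimate
for the Langevin kernels with constants UNIFORM in the bias `|δ| < δ₀` towards invariant probability
measures `ν_δ` with `ν_δ(e^{ϑH}) ≤ C`. CONCLUSION: a response coefficient `D` exists,
`SiteChain.IsResponseCoeff N T D`. Route (all tree facts, ported to `SiteChain` in
`Literature/…/SiteChainResponse*.lean`, `SiteChainKernelContinuity.lean`, `SiteChainGibbsWeight.lean`):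
(G4) `ν_δ` is a weak steady state (Dynkin + invariance; currents dominated by `e^{ϑH}`), hence THE
steady state `μ_δ` by uniqueness, so `J_N(μ_δ) = ν_δ(J)`; (G5) the exact response identity ★
`ν_δ(J) Z = δ (γ/2T²) I(δ)` (`Z = ∫ e^{-H/T}`, `I(δ)` the odd-moment pairing of the biased kernels;
the equilibrium current `∫ e^{-H/T} J dx` vanishes by momentum reversal); (G6) `I(δ) → I(0)` from the
uniform mixing estimate. Hence `J_N(μ_δ)/δ = (γ/2T²Z) I(δ) → (γ/2T²Z) I(0) =: D`.
-/

noncomputable section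

namespace Summit.AtomisticToContinuum.FouriersLaw.Theorems.PrefixSteadyStates.LineRegistered

open MeasureTheory ProbabilityTheory Filter Topology Set
open scoped NNReal ENNReal ContDiff
open Literature.MathematicalPhysics.KineticTheory.HeatConduction
open Literature.MathematicalPhysics.KineticTheory Literature.Probability.Process

/-! ### The total current of a cell chain is smooth -/

/-- The total current `J = ∑_i j_i` of a cell chain is `C²` (the bond potentials are smooth).
[folklore] -/
theorem cellChain_contDiff_sum_bondCurrent (ω₂ lam β γ : ℝ) (c : ℕ → Bool) (N : ℕ) :
    ContDiff ℝ 2 fun y : PhaseSpace N => ∑ i : Fin N, (cellChain ω₂ lam β γ c).bondCurrent N i y := by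
  refine ContDiff.sum fun i _ => ?_
  have hV' : ∀ m : ℕ, ContDiff ℝ 2 (deriv ((cellChain ω₂ lam β γ c).V m)) := fun m =>
    (cellChain_contDiff_V ω₂ lam β γ c m (n := (2 : ℕ∞) + 1)).deriv'
  unfold SiteChain.bondCurrent
  refine ContDiff.sum fun j _ => ?_
  split_ifs
  · exact (((((contDiff_apply ℝ ℝ i).comp contDiff_snd).add ((contDiff_apply ℝ ℝ j).comp contDiff_snd)).div_const
      2).mul ((hV' _).comp (((contDiff_apply ℝ ℝ j).comp contDiff_fst).sub
        ((contDiff_apply ℝ ℝ i).comp contDiff_fst)))).neg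
  · exact contDiff_const

/-! ### The stub -/

/-- **Stub (G4+G5+G6): the response coefficient of the prefix rung exists, given weak-NESS
existence/uniqueness and a uniform mixing estimate near `(T, T)`.** For `P = cellChain ω₂ lam β γ (· < k)`
(`0 < k < N`, parameters `> 0`), the unique steady states `μ(T_L, T_R)` form the family; for
`0 < |δ| < δ₀` the mixing limit `ν_δ` is a weak steady state (Dynkin's identity integrated against the
invariant `ν_δ`; currents are `ν_δ`-integrable since `e^{ϑH} ∈ L¹(ν_δ)`), hence `ν_δ = μ_δ`; the exact
response identity `ν_δ(J) · Z = δ (γ/2T²) I(δ)` (finite-time Duhamel identity at the mean-temperature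
Gibbs weight, `t → ∞` by the mixing estimate, `∫ e^{-H/T} J = 0`) and the continuity `I(δ) → I(0)`
(pathwise continuity of the flow in the noise amplitudes + uniform moment bounds) give
`J_N(μ_δ)/δ = (γ/2T²Z) I(δ) → D`. [cite: KunduDharNarayan2009, p. 3]
[cite: CuneoEckmannHairerReyBellet2018, Thm 2.13 eq. (2.5)] -/
theorem stub_prefixResponseOfUniformMixing :
    ∀ ω₂ lam β γ : ℝ, 0 < ω₂ → 0 < lam → 0 < β → 0 < γ → ∀ k N : ℕ, 0 < k → k < N →
      (∀ T_L T_R : ℝ, 0 < T_L → 0 < T_R →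
        ∃ μ : Measure (PhaseSpace N),
          (cellChain ω₂ lam β γ (fun i => decide (i < k))).IsSteadyState N T_L T_R μ ∧
          ∀ ν : Measure (PhaseSpace N),
            (cellChain ω₂ lam β γ (fun i => decide (i < k))).IsSteadyState N T_L T_R ν → ν = μ) →
      ∀ T : ℝ, 0 < T →
        (∃ (δ₀ ϑ C c : ℝ), 0 < δ₀ ∧ δ₀ < 2 * T ∧ 0 < ϑ ∧ ϑ * (T + δ₀ / 2) < 1 ∧ 0 ≤ C ∧ 0 < c ∧
          ∀ δ : ℝ, |δ| < δ₀ →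
            ∃ ν : Measure (PhaseSpace N), IsProbabilityMeasure ν ∧
              (∀ t : ℝ≥0, ProbabilityTheory.Kernel.Invariant
                ((cellChain ω₂ lam β γ (fun i => decide (i < k))).langevinKernel N (T + δ / 2) (T - δ / 2) t) ν) ∧
              (∫ y, Real.exp (ϑ * (cellChain ω₂ lam β γ (fun i => decide (i < k))).hamiltonian N y) ∂ν ≤ C) ∧
              ∀ (z : PhaseSpace N) (t : ℝ≥0) (f : PhaseSpace N → ℝ), Continuous f →
                (∀ y, |f y| ≤ Real.exp (ϑ * (cellChain ω₂ lam β γ (fun i => decide (i < k))).hamiltonian N y)) →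
                |(∫ y, f y ∂((cellChain ω₂ lam β γ (fun i => decide (i < k))).langevinKernel N
                      (T + δ / 2) (T - δ / 2) t z)) - ∫ y, f y ∂ν| ≤
                  C * Real.exp (ϑ * (cellChain ω₂ lam β γ (fun i => decide (i < k))).hamiltonian N z) *
                    Real.exp (-c * t)) →
        ∃ D : ℝ, (cellChain ω₂ lam β γ (fun i => decide (i < k))).IsResponseCoeff N T D := by
  intro ω₂ lam β γ hω hl hβ hγ k N hk hkN hU T hT hM
  obtain ⟨δ₀, ϑ, C, c, hδ₀, hδ₀T, hϑ, hϑT', hC0, hc, hmixU⟩ := hM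
  set P := cellChain ω₂ lam β γ (fun i => decide (i < k)) with hPdef
  have hP : P.UniformlyConfining := cellChain_uniformlyConfining hω hl.le hβ.le hγ.le _
  have hN : 0 < N := by omega
  have hγP : 0 < P.γ := hγ
  have hϑT : -1 / T + ϑ < 0 := by
    have h1 : ϑ * T < 1 := by nlinarith
    have h2 : ϑ < 1 / T := by rwa [lt_div_iff₀ hT]
    have h3 : -1 / T = -(1 / T) := by ring
    linarith
  have hZ : ∀ a : ℝ, a < 0 → Integrable fun x : PhaseSpace N => Real.exp (a * P.hamiltonian N x) :=
    fun a ha => cellChain_integrable_exp_mul_hamiltonian hω hl.le hβ.le γ _ N ha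
  have hH0 : ∀ x, 0 ≤ P.hamiltonian N x := hP.hamiltonian_nonneg N
  have hU1 : ∀ i, ContDiff ℝ 1 (P.U i) := fun i => cellChain_contDiff_U ω₂ lam β γ _ i
  have hV1 : ∀ i, ContDiff ℝ 1 (P.V i) := fun i => cellChain_contDiff_V ω₂ lam β γ _ i
  -- the steady-state family: the unique steady states
  classical
  let μf : ℝ → ℝ → Measure (PhaseSpace N) := fun T_L T_R =>
    if h : 0 < T_L ∧ 0 < T_R then Classical.choose (hU T_L T_R h.1 h.2) else 0
  have hμf : ∀ T_L T_R : ℝ, 0 < T_L → 0 < T_R →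
      P.IsSteadyState N T_L T_R (μf T_L T_R) ∧ ∀ ν, P.IsSteadyState N T_L T_R ν → ν = μf T_L T_R := by
    intro T_L T_R hL hR
    simp only [μf, dif_pos (And.intro hL hR)]
    exact Classical.choose_spec (hU T_L T_R hL hR)
  -- the total current
  set J : PhaseSpace N → ℝ := fun y => ∑ i : Fin N, P.bondCurrent N i y with hJ
  have hJ2 : ContDiff ℝ 2 J := cellChain_contDiff_sum_bondCurrent ω₂ lam β γ _ N
  have hJc : Continuous J := hJ2.continuous
  obtain ⟨MJ, hMJ0, hJM⟩ := hP.exists_abs_sum_bondCurrent_le_exp N (half_pos hϑ)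
  have hJM' : ∀ y, |J y| ≤ MJ * Real.exp (ϑ * P.hamiltonian N y) := fun y =>
    (hJM y).trans (mul_le_mul_of_nonneg_left (Real.exp_le_exp.2 (by nlinarith [hH0 y])) hMJ0)
  -- the partition integral
  set Z : ℝ := ∫ x, Real.exp (-1 / T * P.hamiltonian N x) with hZdef
  have hZpos : 0 < Z := integral_exp_pos (hZ _ (by rw [neg_div, neg_lt_zero]; positivity))
  -- no equilibrium current
  have hJ0 : ∫ x, Real.exp (-1 / T * P.hamiltonian N x) * J x = 0 :=
    P.integral_exp_mul_hamiltonian_mul_sum_bondCurrent N (-1 / T)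
  -- the odd-moment pairing
  set I : ℝ → ℝ := fun δ => ∫ s in Ioi (0 : ℝ), ∫ x,
    (∫ y, J y ∂(P.langevinKernel N (T + δ / 2) (T - δ / 2) s.toNNReal x)) *
      (Real.exp (-1 / T * P.hamiltonian N x) * (x.2 ⟨0, hN⟩ ^ 2 - x.2 ⟨N - 1, by omega⟩ ^ 2)) with hI
  -- (G4)+(G5): for `0 < |δ| < δ₀`, `J_N(μ_δ) · Z = δ (γ/2T²) I(δ)`
  have key : ∀ δ : ℝ, δ ≠ 0 → |δ| < δ₀ →
      P.totalCurrent (μf (T + δ / 2) (T - δ / 2)) * Z = δ * (P.γ / (2 * T ^ 2)) * I δ := by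
    intro δ hδ0 hδ
    have hδ' := abs_lt.1 hδ
    have hTL : 0 < T + δ / 2 := by linarith
    have hTR : 0 < T - δ / 2 := by linarith
    obtain ⟨ν, hνP, hinv, hνC, hmix⟩ := hmixU δ hδ
    -- `e^{ϑH} ∈ L¹(ν)`
    obtain ⟨hνint, -⟩ := hP.exp_moment_bound_of_mixing N (T + δ / 2) (T - δ / 2) hϑ.le hc.le hνC hmix
    -- (G4) `ν` is a weak steady state, hence THE steady state
    have hνss : P.IsSteadyState N (T + δ / 2) (T - δ / 2) ν := by
      refine ⟨hνP, fun f hf hfc => ?_, fun i => ?_⟩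
      · have hf2 : ContDiff ℝ 2 f := hf.of_le (by norm_cast)
        set S := hP.semigroup N (T + δ / 2) (T - δ / 2) hN hTL.le hTR.le with hS
        have hinv' : S.IsInvariant ν := fun t => hinv t
        exact MarkovSemigroupFor.IsInvariant.integral_generator_eq_zero S hinv' hf hfc
          (siteChain_continuous_generator _ hU1 hV1 N _ _ hf2).stronglyMeasurable
          ((siteChain_continuous_generator _ hU1 hV1 N _ _ hf2).bounded_above_of_compact_support
            (siteChain_hasCompactSupport_generator _ N _ _ hf2 hfc))
      · refine (hνint.const_mul ((N : ℝ) * ((3 + β) / 2) * (2 * Real.exp ϑ / ϑ ^ 2))).mono'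
          (cellChain_continuous_bondCurrent ω₂ lam β γ _ N i).aestronglyMeasurable
          (Eventually.of_forall fun x => ?_)
        rw [Real.norm_eq_abs]
        have hsq := one_add_sq_le_exp (hH0 x) hϑ
        calc |P.bondCurrent N i x| ≤ N * ((3 + β) / 2 * (1 + P.hamiltonian N x) ^ 2) :=
              cellChain_abs_bondCurrent_le hω.le hl.le hβ.le γ _ N i x
          _ = N * ((3 + β) / 2) * (1 + P.hamiltonian N x) ^ 2 := by ring
          _ ≤ N * ((3 + β) / 2) * (2 * Real.exp ϑ / ϑ ^ 2 * Real.exp (ϑ * P.hamiltonian N x)) :=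
              mul_le_mul_of_nonneg_left hsq (by positivity)
          _ = _ := by ring
    have hνeq : ν = μf (T + δ / 2) (T - δ / 2) := (hμf _ _ hTL hTR).2 ν hνss
    -- `J_N(μ_δ) = ν(J)`
    have htc : P.totalCurrent (μf (T + δ / 2) (T - δ / 2)) = ∫ y, J y ∂ν := by
      rw [← hνeq]
      simp only [SiteChain.totalCurrent, hJ]
      rw [integral_finsetSum _ fun i _ => hνss.2.2 i]
    -- (G5) ★
    have hstar := hP.forecast_limit_mul_partition_eq_of_mixing hN hγP hT hTL.le hTR.le hδ0 hϑ hϑT hc hνC hmix hZ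
      hJ2 hJM'
    rw [hJ0, sub_zero] at hstar
    rw [htc]
    exact hstar
  -- (G6) continuity of the pairing at `δ = 0`
  have hcont : Tendsto I (𝓝[≠] 0) (𝓝 (∫ s in Ioi (0 : ℝ), ∫ x, (∫ y, J y ∂(P.langevinKernel N T T s.toNNReal x)) *
      (Real.exp (-1 / T * P.hamiltonian N x) * (x.2 ⟨0, hN⟩ ^ 2 - x.2 ⟨N - 1, by omega⟩ ^ 2)))) :=
    hP.tendsto_oddMoment_pairing_of_uniform_mixing hN hγP hT hδ₀ hδ₀T hϑ hϑT hc hZ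
      (fun δ hδ => by
        obtain ⟨ν, hνP, -, hνC, hmix⟩ := hmixU δ hδ
        exact ⟨ν, hνP, hνC, hmix⟩) hJc hJM
  set I₀ : ℝ := ∫ s in Ioi (0 : ℝ), ∫ x, (∫ y, J y ∂(P.langevinKernel N T T s.toNNReal x)) *
      (Real.exp (-1 / T * P.hamiltonian N x) * (x.2 ⟨0, hN⟩ ^ 2 - x.2 ⟨N - 1, by omega⟩ ^ 2)) with hI₀
  -- the response coefficient
  refine ⟨P.γ / (2 * T ^ 2) / Z * I₀, μf, fun T_L T_R hL hR => (hμf T_L T_R hL hR).1, ?_⟩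
  have hev : ∀ᶠ δ in 𝓝[≠] (0 : ℝ), P.γ / (2 * T ^ 2) / Z * I δ = P.totalCurrent (μf (T + δ / 2) (T - δ / 2)) / δ := by
    have h1 : ∀ᶠ δ in 𝓝 (0 : ℝ), |δ| < δ₀ := by
      have : ∀ᶠ δ in 𝓝 (0 : ℝ), δ ∈ Ioo (-δ₀) δ₀ := Ioo_mem_nhds (by linarith) hδ₀
      filter_upwards [this] with δ hδ using abs_lt.2 ⟨hδ.1, hδ.2⟩
    filter_upwards [mem_nhdsWithin_of_mem_nhds h1, self_mem_nhdsWithin] with δ hδ hδ0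
    have hδ0' : δ ≠ 0 := hδ0
    have hZ0 : Z ≠ 0 := hZpos.ne'
    have hk : P.totalCurrent (μf (T + δ / 2) (T - δ / 2)) = δ * (P.γ / (2 * T ^ 2)) * I δ / Z := by
      rw [eq_div_iff hZ0]
      exact key δ hδ0' hδ
    rw [hk]
    field_simp
  exact ((hcont.const_mul (P.γ / (2 * T ^ 2) / Z)).congr' hev)

end Summit.AtomisticToContinuum.FouriersLaw.Theorems.PrefixSteadyStates.LineRegistered

end
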